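import Summits.ABC.IUTFork.Joshi.ATS4LogDiffConductor
import Summits.ABC.IUTFork.Joshi.ATS4Differents
import Summits.ABC.IUTFork.Joshi.ATS4RamificationTateDivisor
import HarnessLib

/-!
# Joshi, *Arithmetic Teichmüller Spaces IV* (arXiv:2403.10430v2) Thm. 4.6.1 (2) in the §4.3–§4.4 vocabulary of the cell —
# merge-debt bridge `LogDiffCond` (slot T-27) ↔ `logDifferent` / `TateDivisorDatum` (slot T-26)

Proof-only companion of `Joshi/ATS4LogDiffConductor.lean` (abc-iut cell, branch E, rung LADDER-ABC:A2.E; seat abc-iut-E-t27).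
**No side is taken** on [IUTchIII] Cor. 3.12, on Joshi's claims, or on Mochizuki's reports on them; the source is an unrefereed
arXiv preprint. Locators «p.N l.M» refer to the render `HOME/lit/renders/Joshi-arxiv-2403.10430/` (v2).

The interim-carrier rule (plan/E/ASSIGNMENTS.md §0.3) left three vocabularies for the same printed numbers `log d_M`, `log f_M`
of [J-IV] §4.3–§4.4: `LogDiffCond.logDiff` / `LogDiffCond.logRedTate` (T-27, over Mathlib's `differentIdeal ℤ (𝓞 M)` and
`Ideal.absNorm`), `logDifferent` / `TateDivisorDatum.logf` (T-26, over the tree's arithmetic divisors `ndeg`, `differentDivisor`,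
`ADivisor.reduced`), and the abstract real fields `logDiff·` / `logCond·` of `MainBoundDatum` (T-30, §6.1). This file pays the
merge-debt between the first two: they AGREE up to unfolding `log|disc M|` (`logDiff_eq_logDifferent`, `logRedTate_eq_logf`), so the
kernel proof of **Thm. 4.6.1 (2)** (p.46 l.36–37, `LogDiffCond.logDiffCond_le`, from the tree's [GenEll] Prop. 1.7 (i) engine)
transfers: `logDifferent L + 𝔮_L.logf ≤ logDifferent M + 𝔮_M.logf` whenever `V^{odd,ss}_M ⊇` the primes over `V^{odd,ss}_L`
(`thm461_2_tateDivisorDatum`), in particular under T-26's base-change relation `IsBaseChangeOf` (p.40 l.35–40 «V^{odd,ss}_M is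
the inverse image …»). T-30's reading predicate `MainBoundDatum.DiffCondMono` («log(d^{L_tpd}) + log(f^{L_tpd}) ≤ log(d^L) + log(f^L)»,
the monotonicity behind the second inequality of Thm. 6.1.1) then follows for every datum whose four fields are these degrees of
actual number fields `L_tpd ⊆ L`, by `thm461_2_tateDivisorDatum` and four rewrites (left to the instantiating file of
`Joshi/ATS4MainBounds.lean`). Theorems only; no definition, instance, notation or new `Prop` fact; standard axioms.
[claim: Joshi2024ATS4, status: disputed] (provenance of the typed items; nothing endorsed).
-/

noncomputable section

namespace Summit.ABC.IUTFork.Joshi.ATS4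

namespace LogDiffCond

open NumberField IsDedekindDomain Ideal Module Literature.IUT.LogVolume

variable (L M : Type*) [Field L] [NumberField L] [Field M] [NumberField M] [Algebra L M]

omit [NumberField L] [NumberField M] in
/-- T-26's `finBelow L M w` («the place of `L` under `w`») is Mathlib's bundled pull-back `w.under (𝓞 L)` used by T-27.
[folklore] -/
theorem finBelow_eq_under (w : HeightOneSpectrum (𝓞 M)) : finBelow L M w = w.under (𝓞 L) :=
  HeightOneSpectrum.ext rfl

/-- **`log d_M`: the two typings agree** — `LogDiffCond.logDiff M` (`[M:ℚ]⁻¹·log N(𝔡_{𝓞_M/ℤ})`) `=` T-26's `logDifferent M`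
(`ndeg` of the different divisor); both equal `[M:ℚ]⁻¹·log|disc M|` ([J-IV] Prop. 4.3.5 p.40 l.16–21).
[cite: BombieriGubler2006, Prop B.1.19] -/
theorem logDiff_eq_logDifferent : logDiff M = logDifferent M := by
  rw [logDiff_eq_log_discr, logDifferent_eq_log_discr, div_eq_inv_mul]

/-- **`log f_M`: the two typings agree** — `LogDiffCond.logRedTate M V` `=` T-26's `TateDivisorDatum.logf` for a Tate-divisor
datum with semistable support `V` ([J-IV] §4.4 p.41 l.2–14, «log w» = `log N(w)`). [folklore] -/
theorem logRedTate_eq_logf (𝔮 : TateDivisorDatum M) : logRedTate M 𝔮.V = 𝔮.logf := by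
  rw [TateDivisorDatum.logf_eq_sum, logRedTate, div_eq_inv_mul]
  rfl

/-- `log d_M + log f_M` in the two vocabularies. [folklore] -/
theorem logDiffCond_eq_logDifferent_add_logf (𝔮 : TateDivisorDatum M) :
    logDiffCond M 𝔮.V = logDifferent M + 𝔮.logf := by
  rw [logDiffCond, logDiff_eq_logDifferent, logRedTate_eq_logf]

/-- **[J-IV] Theorem 4.6.1 (2) in T-26's vocabulary — PROVED**: for number fields `L ⊆ M` with Tate-divisor data `𝔮_L`, `𝔮_M`
such that every prime of `M` over `V^{odd,ss}_L` lies in `V^{odd,ss}_M`,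
`log d_L + log f_L ≤ log d_M + log f_M` (p.46 l.36–37). [cite: MochizukiGenEll2010, Prop 1.7 (i) p.9] -/
theorem thm461_2_tateDivisorDatum (𝔮L : TateDivisorDatum L) (𝔮M : TateDivisorDatum M)
    (hV : ∀ w : HeightOneSpectrum (𝓞 M), finBelow L M w ∈ 𝔮L.V → w ∈ 𝔮M.V) :
    logDifferent L + 𝔮L.logf ≤ logDifferent M + 𝔮M.logf := by
  rw [← logDiffCond_eq_logDifferent_add_logf, ← logDiffCond_eq_logDifferent_add_logf]
  exact logDiffCond_le L M 𝔮L.V 𝔮M.V fun w hw => hV w (by rwa [finBelow_eq_under])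

/-- **Thm. 4.6.1 (2) under T-26's base-change relation** (`TateDivisorDatum.IsBaseChangeOf`: `V^{odd,ss}_M` is EXACTLY the inverse
image of `V^{odd,ss}_L` and the local heights scale by `e_{w|v}`, p.40 l.35 – p.41 l.42): `log d_L + log f_L ≤ log d_M + log f_M`.
PROVED. [cite: MochizukiGenEll2010, Prop 1.7 (i) p.9] -/
theorem thm461_2_of_isBaseChangeOf (𝔮L : TateDivisorDatum L) (𝔮M : TateDivisorDatum M) (h : 𝔮M.IsBaseChangeOf 𝔮L) :
    logDifferent L + 𝔮L.logf ≤ logDifferent M + 𝔮M.logf :=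
  thm461_2_tateDivisorDatum L M 𝔮L 𝔮M fun w hw => (h.1 w).mpr hw

/-- The set `ssAbove L M V^{odd,ss}_L` of T-27 is the support `V^{odd,ss}_M` of any `M`-datum in base-change relation with the
`L`-datum (both are «the inverse image», p.40 l.35–40). [folklore] -/
theorem ssAbove_eq_V_of_isBaseChangeOf (𝔮L : TateDivisorDatum L) (𝔮M : TateDivisorDatum M) (h : 𝔮M.IsBaseChangeOf 𝔮L) :
    ssAbove L M 𝔮L.V = 𝔮M.V := by
  ext w
  rw [mem_ssAbove, ← finBelow_eq_under, h.1 w]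

end LogDiffCond

end Summit.ABC.IUTFork.Joshi.ATS4

end
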